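import Summits.RiemannHypothesis.RiemannHypothesis.Theorems.TiltedLandingLaw421R3TouchedDissipation
import Summits.RiemannHypothesis.RiemannHypothesis.Theorems.TiltedLandingLaw421R3ColumnImmunity

/-!
# T⁗ — the FRAME-WEIGHTED log-profile dissipation SOCKET `TouchedDissipationLawWQ cF L κ₀` and its instance `TouchedDissipationLawTQ c L κ₀ θ`
(lens-2 g7; TYPED per (CA680)(D2) after CUT 34; memo `lens2/TQ-FRAMEWISE-MEMO-v1.md` ad1b401b, decldiff `lens2/GLUE-V5-DECLDIFF-v1.md` f8dc3f57; a LAW, unproved)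
ONE tree import (C′ module `…R3TouchedDissipation`, #1178).  Self-contained: the log weight `logWeight` of the dead T‴ draft (`lens2/TouchedDissipationL-v1.lean`
64d6c277, never landed) is re-homed here (§1).  PARAMETERS: `c` (dissipation constant), `L` (log slope), `κ₀` (field floor) — binders; `θ` (weight slope) a
binder of the general instance, with the value of record `thetaW = 2` a binder-free def (§1, justified there); NOTHING ELSE BAKED.
STATEMENT.  Same population as C′/T‴ (legal frame; CHARGED APPROACH level `j`; lowest band state `v` touched by a strictly taller zero `z` of `f⁽ʲ⁾`; the
pair atomic; `κ₀ ≤ Im v·κ_v`); with `e := Im v² + Im z²`, `y(e) := 1 + L·log(2Hs²/e)`:   `cF(F)·s² ≤ η²·y(e)²·(e − childEnergy Ū)`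
— T‴'s inequality VERBATIM with the global constant `c` replaced by a FRAME FUNCTIONAL `cF : Budget` (a function of the datum `(η,f,x₀,s,hmax,R,Hs,B)`
only, like every budget of the books).  [Erratum to the decldiff's one-liner, which put `y²` on the left: the benches' merit is `M_row(L) = X″·y²`, so `y²`
multiplies `ΔE`, as in T‴ and in the glue's paying inequality.]  T⁗ = the instance `cF := c / w_F`, `w_F := max(1, θ·(B+1)·(s/Hs)²)` (`frameWeightQ`):
big-`B` frames (one-sided fences, towers: B ≈ 60–110·(Hs/s)²) get the SMALL constant; balanced frames (`w_F = 1`) must carry `c` itself.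
BENCH OF RECORD (crit-1 CUT 34, (CA680), floats): decision number min over LEGAL ∧ CHARGED rows of `M_row(L)·w_F/need(.66, L)` = ×4.2 (row «W2F», L = 0)
among balanced frames, ≥ ×30 among one-sided frames; my predicted killer «W2F-tall» was neither legal nor charged; next adversary named: «W2F-sparse» (l.8232).
CUT 35 («W2F-sparse», C6 scout, (CA690)): uncharged at every gap ⇒ by my pre-stated words «no further adversary in the depleted/balanced class at this level».
B-CURRENCY (CA690)(B): `w_F` reads the TREE budget `B` of the datum (`HalfSlabBudget`: each side's count against the density `1/s`, never a left–right
balance residue) — frames without a dense two-sided sea have `B ≈ R/s` and large relief; dense seas pull the children down (X″ ×4).  §4 = the INSTANCE OF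
RECORD chosen after CUT 34/35, with its margin table.  KILL: a legal charged atomic approach β-row with `X″·y_L(u)²·w_F < c` at the instance under test.
Nothing here bears on the truth of RH; RH is not proved; T⁗ is a typed LAW (OPEN), it survived ONE cut as a candidate; T″/T‴ dead; C′ typed not proved;
★A / 33346 / 33347 OPEN; checked ≠ landed ≠ proved. -/

namespace RhW08.TouchedDissipationW

open Complex
open scoped ComplexConjugate
open RhW08.Round1 RhW08.StSwap RhW08.Round2 RhW08.QuadW
open RhW08.SealSwap (PBot)
open RhW08.SealSwapQ RhW08.RateSplit RhW08.BurgersRate RhW08.BurgersRateG3 RhW08.TouchedDissipation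
open RhIdea6.G17.W07C7 RhIdea6.G17.W07C7.Rev6 RhIdea6.G18.W07C8.Law421BirthS RhIdea6.G19.W07C11.Seam
open RhIdea6.G20.W07C12.Frac RhIdea6.G20.W07C12.StColP RhW07.C12.FieldSplit RhIdea6.G21.W07C13.TentMax
open RhW07.C14.TwoSided RhW07.C14.Classes RhW07.C14.Lineage RhW07.C14.Booking

/-! ## §1 Weights -/

/-- §1 the LOG-PROFILE WEIGHT `y(E) = 1 + L·log(2Hs²/E)` of an energy `E` in a strip of height `Hs` (`= 1` at `E = 2Hs²`; Lean junk: `E = 0 ⇒ y = 1`). -/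
noncomputable def logWeight (L Hs E : ℝ) : ℝ := 1 + L * Real.log (2 * Hs ^ 2 / E)

/-- §1 the FRAME WEIGHT `w_F := max(1, θ·(B+1)·(s/Hs)²)` — a `Budget` (function of the frame datum only); `≥ 1`; reads `1` whenever `θ·(B+1) ≤ (Hs/s)²`. -/
noncomputable def frameWeightQ (θ : ℝ) : Budget := fun _η _f _x₀ s _hmax _R Hs B => max 1 (θ * ((B : ℝ) + 1) * (s / Hs) ^ 2)

/-- §1 the WEIGHTED CONSTANT `c_F := c / w_F`. -/
noncomputable def weightedConstQ (c θ : ℝ) : Budget := fun η f x₀ s hmax R Hs B => c / frameWeightQ θ η f x₀ s hmax R Hs B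

/-- §1 the weight slope OF RECORD `θ_W := 2` (binder-free).  WHY THIS VALUE, and why it is not a hand-picked truth threshold (checklist 4c(iv)): the law
`TouchedDissipationLawTQ c L κ₀ θ` is WEAKER for LARGER `θ` (`lawTQ_mono_theta`), so `θ` is capped only by what the BOOKS can pay: FIT_W's B-bracket
(`approachBudgetHalfQ` carries `(3/2)·(B+1)` of capital per frame, `approachBudgetHalf_apply`) reads `φ₀·θ ≤ 3/2` with `φ₀ = (1+2L+2L²)/(2c)`, i.e.
`θ ≤ 3/(2φ₀) ∈ [2, 2.5]` on the purse factors of record `φ₀ ∈ [0.6, 0.75]`; `2` is the largest value payable across that whole range.  Any other `θ` is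
another INSTANCE of the socket, not an edit of this file. -/
def thetaW : ℝ := 2

/-! ## §2 The socket and the law (parameters only; nothing instantiated numerically except `thetaW`) -/

/-- (SOCKET W — FRAME-WEIGHTED LOG-PROFILE DISSIPATION ON TOUCHED APPROACH LEVELS; typed, OPEN) for a frame functional `cF`: on a legal frame, at a
CHARGED APPROACH level `j` whose lowest band state `v` is touched by a strictly taller zero `z` of `f⁽ʲ⁾` (`Touches`), the pair atomic (`AtomicPair`),
the state field above the floor (`κ₀ ≤ Im v·κ_v`): `cF(F)·s² ≤ η²·(1 + L·log(2Hs²/(Im v² + Im z²)))²·((Im v² + Im z²) − childEnergy(Ū))`. -/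
def TouchedDissipationLawWQ (cF : Budget) (L κ₀ : ℝ) : Prop :=
  ∀ (η : ℝ) (f : ℂ → ℂ) (x₀ s hmax R Hs : ℝ) (B : ℕ), EngineHyps5 2 η f x₀ s hmax R Hs B →
    ∀ (j : ℕ) (v z : ℂ), Charged (PTrkSQ PBot) StTrkDQ ReadyR2 η f x₀ s hmax R Hs B j → ApproachLevelQ η f x₀ s hmax R Hs B j →
      IsLowest StTrkDQ η f x₀ s hmax R Hs B j v → Touches f j v z → AtomicPair f j v z →
      κ₀ ≤ v.im * stateKappa f j v →
      cF η f x₀ s hmax R Hs B * s ^ 2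
        ≤ η ^ 2 * logWeight L Hs (v.im ^ 2 + z.im ^ 2) ^ 2 * ((v.im ^ 2 + z.im ^ 2) - childEnergy f j (pairUnion v z))

/-- (LAW T⁗(c, L, κ₀, θ) — typed, OPEN) the socket at the weighted constant `c / max(1, θ·(B+1)·(s/Hs)²)`. -/
def TouchedDissipationLawTQ (c L κ₀ θ : ℝ) : Prop := TouchedDissipationLawWQ (weightedConstQ c θ) L κ₀

/-- (LAW T⁗ OF RECORD — `θ = thetaW = 2`; `c, L, κ₀` parameters) -/
def TouchedDissipationLawTWQ (c L κ₀ : ℝ) : Prop := TouchedDissipationLawTQ c L κ₀ thetaW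

/-! ## §3 Bookkeeping (K) -/

/-- (K) `y(2Hs²) = 1` (also for `Hs = 0`). -/
theorem logWeight_top (L Hs : ℝ) : logWeight L Hs (2 * Hs ^ 2) = 1 := by
  unfold logWeight
  by_cases h : 2 * Hs ^ 2 = 0
  · rw [h]; simp
  · rw [div_self h, Real.log_one]; ring

/-- (K) `1 ≤ y(E)` for `0 ≤ L`, `0 < E ≤ 2Hs²`. -/
theorem one_le_logWeight {L Hs E : ℝ} (hL : 0 ≤ L) (hE : 0 < E) (hEA : E ≤ 2 * Hs ^ 2) : 1 ≤ logWeight L Hs E := by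
  unfold logWeight
  have hlog : 0 ≤ Real.log (2 * Hs ^ 2 / E) := Real.log_nonneg ((one_le_div hE).2 hEA)
  nlinarith

/-- (K) `1 ≤ w_F`, hence `0 < w_F`. -/
theorem one_le_frameWeightQ (θ η : ℝ) (f : ℂ → ℂ) (x₀ s hmax R Hs : ℝ) (B : ℕ) : 1 ≤ frameWeightQ θ η f x₀ s hmax R Hs B :=
  le_max_left _ _

theorem frameWeightQ_pos (θ η : ℝ) (f : ℂ → ℂ) (x₀ s hmax R Hs : ℝ) (B : ℕ) : 0 < frameWeightQ θ η f x₀ s hmax R Hs B :=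
  one_pos.trans_le (one_le_frameWeightQ θ η f x₀ s hmax R Hs B)

/-- (K) `w_F ≤ 1 + θ·(B+1)·(s/Hs)²` for `0 ≤ θ` (the form FIT_W's two brackets use). -/
theorem frameWeightQ_le {θ : ℝ} (hθ : 0 ≤ θ) (η : ℝ) (f : ℂ → ℂ) (x₀ s hmax R Hs : ℝ) (B : ℕ) :
    frameWeightQ θ η f x₀ s hmax R Hs B ≤ 1 + θ * ((B : ℝ) + 1) * (s / Hs) ^ 2 := by
  have h0 : 0 ≤ θ * ((B : ℝ) + 1) * (s / Hs) ^ 2 := by positivity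
  exact max_le (by linarith) (by linarith)

/-- (K) `w_F` is monotone in `θ`. -/
theorem frameWeightQ_mono {θ θ' : ℝ} (hθ : θ ≤ θ') (η : ℝ) (f : ℂ → ℂ) (x₀ s hmax R Hs : ℝ) (B : ℕ) :
    frameWeightQ θ η f x₀ s hmax R Hs B ≤ frameWeightQ θ' η f x₀ s hmax R Hs B :=
  max_le_max le_rfl (mul_le_mul_of_nonneg_right (mul_le_mul_of_nonneg_right hθ (by positivity)) (sq_nonneg _))

/-- (K) `0 < c ⇒ 0 < c_F`, and `0 ≤ c ⇒ c_F ≤ c`. -/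
theorem weightedConstQ_pos {c : ℝ} (hc : 0 < c) (θ η : ℝ) (f : ℂ → ℂ) (x₀ s hmax R Hs : ℝ) (B : ℕ) :
    0 < weightedConstQ c θ η f x₀ s hmax R Hs B :=
  div_pos hc (frameWeightQ_pos θ η f x₀ s hmax R Hs B)

theorem weightedConstQ_le {c : ℝ} (hc : 0 ≤ c) (θ η : ℝ) (f : ℂ → ℂ) (x₀ s hmax R Hs : ℝ) (B : ℕ) :
    weightedConstQ c θ η f x₀ s hmax R Hs B ≤ c :=
  div_le_self hc (one_le_frameWeightQ θ η f x₀ s hmax R Hs B)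

/-- (K) the socket is DOWNWARD-closed in the frame functional (pointwise on legal frames) and UPWARD-closed in the floor. -/
theorem lawWQ_mono {cF cF' : Budget} {L κ₀ κ₀' : ℝ}
    (hc : ∀ (η : ℝ) (f : ℂ → ℂ) (x₀ s hmax R Hs : ℝ) (B : ℕ), EngineHyps5 2 η f x₀ s hmax R Hs B →
      cF' η f x₀ s hmax R Hs B ≤ cF η f x₀ s hmax R Hs B)
    (hκ : κ₀ ≤ κ₀') (h : TouchedDissipationLawWQ cF L κ₀) : TouchedDissipationLawWQ cF' L κ₀' :=
  fun η f x₀ s hmax R Hs B hE j v z hch hA hlow ht ha hfl =>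
    (mul_le_mul_of_nonneg_right (hc η f x₀ s hmax R Hs B hE) (sq_nonneg s)).trans
      (h η f x₀ s hmax R Hs B hE j v z hch hA hlow ht ha (hκ.trans hfl))

/-- (K) a FRAME-BLIND constant implies the weighted law: `W(const c) → T⁗(c, θ)` for `0 ≤ c` (T‴, were it true, would give T⁗ — sanity only; T‴ is dead). -/
theorem lawTQ_of_const {c L κ₀ : ℝ} (hc : 0 ≤ c) (θ : ℝ) (h : TouchedDissipationLawWQ (fun _ _ _ _ _ _ _ _ => c) L κ₀) :
    TouchedDissipationLawTQ c L κ₀ θ :=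
  lawWQ_mono (fun η f x₀ s hmax R Hs B _ => weightedConstQ_le hc θ η f x₀ s hmax R Hs B) le_rfl h

/-- (K) T⁗ is DOWNWARD-closed in `c`, UPWARD-closed in `κ₀` and in `θ` (larger weight slope = weaker law), for `0 ≤ c'`. -/
theorem lawTQ_mono_theta {c c' L κ₀ κ₀' θ θ' : ℝ} (hc' : 0 ≤ c') (hcc : c' ≤ c) (hκ : κ₀ ≤ κ₀') (hθ : θ ≤ θ')
    (h : TouchedDissipationLawTQ c L κ₀ θ) : TouchedDissipationLawTQ c' L κ₀' θ' := by
  refine lawWQ_mono (fun η f x₀ s hmax R Hs B _ => ?_) hκ h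
  have hw := frameWeightQ_pos θ η f x₀ s hmax R Hs B
  calc weightedConstQ c' θ' η f x₀ s hmax R Hs B ≤ c' / frameWeightQ θ η f x₀ s hmax R Hs B :=
        div_le_div_of_nonneg_left hc' hw (frameWeightQ_mono hθ η f x₀ s hmax R Hs B)
    _ ≤ weightedConstQ c θ η f x₀ s hmax R Hs B := div_le_div_of_nonneg_right hcc hw.le

/-- (K) on a row of the socket with `0 < cF(F)` the energy drop is NON-NEGATIVE (the weight is squared). -/
theorem drop_nonneg_of_lawWQ {cF : Budget} {L κ₀ : ℝ} (h : TouchedDissipationLawWQ cF L κ₀)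
    {η : ℝ} {f : ℂ → ℂ} {x₀ s hmax R Hs : ℝ} {B : ℕ} (hE : EngineHyps5 2 η f x₀ s hmax R Hs B) (hcF : 0 < cF η f x₀ s hmax R Hs B)
    {j : ℕ} {v z : ℂ} (hch : Charged (PTrkSQ PBot) StTrkDQ ReadyR2 η f x₀ s hmax R Hs B j) (hA : ApproachLevelQ η f x₀ s hmax R Hs B j)
    (hlow : IsLowest StTrkDQ η f x₀ s hmax R Hs B j v) (ht : Touches f j v z) (ha : AtomicPair f j v z) (hfl : κ₀ ≤ v.im * stateKappa f j v) :
    0 ≤ (v.im ^ 2 + z.im ^ 2) - childEnergy f j (pairUnion v z) := by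
  have hs : 0 < s := hE.2.2.2.1
  have hrow := h η f x₀ s hmax R Hs B hE j v z hch hA hlow ht ha hfl
  by_contra hneg
  push Not at hneg
  have h0 : η ^ 2 * logWeight L Hs (v.im ^ 2 + z.im ^ 2) ^ 2 * ((v.im ^ 2 + z.im ^ 2) - childEnergy f j (pairUnion v z)) ≤ 0 :=
    mul_nonpos_of_nonneg_of_nonpos (by positivity) hneg.le
  nlinarith [mul_pos hcF (pow_pos hs 2)]

/-- (K) the weighted purse identity FIT_W reads: `1/c_F = w_F/c`. -/
theorem inv_weightedConstQ (c θ η : ℝ) (f : ℂ → ℂ) (x₀ s hmax R Hs : ℝ) (B : ℕ) :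
    1 / weightedConstQ c θ η f x₀ s hmax R Hs B = frameWeightQ θ η f x₀ s hmax R Hs B / c := by
  unfold weightedConstQ
  rw [one_div, inv_div]

/-! ## §4 The instance of record (chosen AFTER CUT 34/35 per (CA690)(C); the numbers below are bench floats / certificates, not proofs) -/

/-- (LAW T⁗★ — THE INSTANCE OF RECORD) `T⁗(c = 2, L = 7/20, κ₀ = 3, θ = thetaW = 2)`.  MARGIN TABLE (need `M_row(0.35)·w_F ≥ 2`, where
`M_row(L) = X″·(1 + L·log(2/u))²`, `w_F = max(1, 2(B+1)(s/Hs)²)`, `B` in TREE currency).  Balanced row «W2F» (u023 fence + two-sided sea 0.12, F = −46,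
B_min 226, (Hs/s)² = 900 ⇒ w_F = 1; CUT 34, two float engines): M(.35) = 6.12 ⇒ margin ×3.06 = THE MINIMUM over the rows of record read with their
tree-currency weight.  One-sided rows need the weight and have it: rowR_u023 (X″ 0.4785 cert, M(.35) = 1.48; B ≥ 11 733 at R = 120 ⇒ w_F ≥ 26 ⇒ ×19);
instr-1's R-free census rows (m(.35) ≈ 1.0–1.3 unweighted; B ≈ 60–110·(Hs/s)² ⇒ w_F ≥ 120 ⇒ × ≥ 60; the exact weighted minimum is instr-1 E3, pending);
WFence8 / WCan4 (X″ 1.49, u ≈ 1 ⇒ M(.35) ≈ 2.3 ⇒ ×1.15 even unweighted); F-tower K = 3 (X″·y² = 3.58 ⇒ ×1.79 unweighted); top-strip two-pair rows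
(m(.35) = 3.03 ⇒ ×1.5 unweighted); C′'s certified low row (X″ 2.89 ⇒ ≥ ×1.45 unweighted).  PESSIMISTIC reading (w_F := 1 everywhere): u023 ×0.74 and the
R-free census rows ≈ ×0.5 FAIL — the weight is load-bearing on one-sided frames BY DESIGN (that is what killed T‴).  FIT side: purse factor
`φ₀★ = (1 + 2L + 2L²)/(2c) = 389/800 ≈ 0.486` ⇒ P-bracket spare `0.6575 − 0.486 ≈ 0.17·(Hs/s)²` for the P-parts of `aT + aRest + (5/4)·riseSup + consSup`
(one full-band charged retouch ≈ 0.18·(Hs/s)², RETOUCH-PRICE-NOTE-v1, sits at that edge) and B-bracket `φ₀★·θ = 0.97 ≤ 3/2` ⇒ `0.53·(B+1)` spare for their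
B-parts.  Any re-fit is ANOTHER instance line; `lawTQ_of_lawTStar` transports proofs of T⁗★ downward in `c`, upward in `κ₀` and `θ`. -/
def TouchedDissipationLawTStarQ : Prop := TouchedDissipationLawTQ 2 (7 / 20) 3 thetaW

/-- (K) §4 the instance constants are admissible and the purse factor is `φ₀★ = 389/800`. -/
theorem lawTStar_consts :
    (0 : ℝ) < 2 ∧ (0 : ℝ) ≤ 7 / 20 ∧ (0 : ℝ) < 3 ∧ (0 : ℝ) ≤ thetaW ∧
      (1 + 2 * (7 / 20 : ℝ) + 2 * (7 / 20) ^ 2) / (2 * 2) = 389 / 800 := by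
  unfold thetaW; norm_num

/-- (K) §4 T⁗★ transports to every weaker instance: `0 ≤ c ≤ 2`, `3 ≤ κ₀`, `thetaW ≤ θ`, same `L = 7/20`. -/
theorem lawTQ_of_lawTStar {c κ₀ θ : ℝ} (hc0 : 0 ≤ c) (hc : c ≤ 2) (hκ : 3 ≤ κ₀) (hθ : thetaW ≤ θ)
    (h : TouchedDissipationLawTStarQ) : TouchedDissipationLawTQ c (7 / 20) κ₀ θ :=
  lawTQ_mono_theta hc0 hc hκ hθ h

end RhW08.TouchedDissipationW


/-!
# Glue v5 — ★A from the T⁗ socket + Γ3′ + Γ4 + FIT_W, with the REPAIRED log-profile potential Φ̃_L (lens-2 g7; (CA680)(D2); HELD; 0 sorry)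
= glue v4 `lens2/TouchedGlue-sketch-v4.lean` dbae8648 with the DECLDIFF of `lens2/GLUE-V5-DECLDIFF-v1.md` f8dc3f57: (i) the global constant `c` becomes the
frame functional `cF : Budget` of the socket `TouchedDissipationLawWQ cF L κ₀` (module `…R3TouchedDissipationW`); T⁗ = the instance `cF = weightedConstQ c θ`;
(ii) crit-1's PRICE-HOLE repair (census l.8164 (iii′): plain Φ_L-rises booked at pre-β levels incl. touch-ON, worst 1.70·purse): the potential is
`Φ̃_k := betaPurse` for `k < firstBetaQ` (the frame's first β-level) and `Φ_L(E_k)` from it on (`betaPotentialWQ`), so the touch-ON rise is a DROP of Φ̃ and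
the rise meter `touchRiseWQ` (re-based on Φ̃) books nothing before the first β-level; (iii) FIT_W per frame: `betaPurseWQ cF L + aT + aRest ≤ budget`, and
for the T⁗ instance the TWO-BRACKET form `φ₀·(Hs/s)² + φ₀·θ·(B+1) + aT + aRest ≤ approachBudgetHalfQ riseSupQ consSupQ` (`approachC_of_TQ_brackets`;
`φ₀ = (1+2L+2L²)/(2c)`).  Token-identical from v4: §G0 (Φ_L algebra), the level objects, Γ2′ `PersistenceOrRetouchQ`, every §G3 lemma on heights/energies/
`phiLE`, §G5 `classLawQ_mono`/`approachAllowanceQ_of_beta_rest`.  Imports: module W (one tree import itself) + `…R3ColumnImmunity` (strip heredity).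
THE GLUE (PROVED; the gaps are the NAMED TYPED HYPOTHESES): `approachC_of_TW : (∀ legal F, 0 < cF F) → 0 ≤ L → W(cF, L, κ₀) → Γ3′ TouchRiseLawWQ cF L κ₀ aT →
Γ4 ClassLawQ (Approach ∖ β) aRest → FIT_W → ApproachAllowanceQ (approachBudgetHalfQ aR aC)`; canonical instance = the registry's `stub_approachC` type.
★A DECOMPOSITION OF RECORD rev 7: C′ + T⁗(c, L, κ₀, θ) + Γ2′ + Γ3′(Σ RTB ≤ aT) + Γ4 + FIT_W, all constants PARAMETERS; numbers only from certified rows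
(decision number of record ×4.2, CUT 34, floats).  Nothing here bears on the truth of RH; RH is not proved; T⁗/Γ3′/Γ4 are LAWS (typed, unproved), C′ typed
not proved; ★A / 33346 / 33347 OPEN; checked ≠ landed ≠ proved. -/

namespace RhW08.TouchedGlueW

open Complex
open scoped ComplexConjugate
open RhW08.Round1 RhW08.StSwap RhW08.Round2 RhW08.QuadW
open RhW08.SealSwap (PBot)
open RhW08.SealSwapQ RhW08.RateSplit RhW08.BurgersRate RhW08.BurgersRateG3 RhW08.TouchedDissipation RhW08.TouchedDissipationW
open RhIdea6.G17.W07C7 RhIdea6.G17.W07C7.Rev6 RhIdea6.G18.W07C8.Law421BirthS RhIdea6.G19.W07C11.Seam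
open RhIdea6.G20.W07C12.Frac RhIdea6.G20.W07C12.StColP RhW07.C12.FieldSplit RhIdea6.G21.W07C13.TentMax
open RhW07.C14.TwoSided RhW07.C14.Classes RhW07.C14.Lineage RhW07.C14.Booking

/-! ## §G0 The Φ_L algebra (pure real functions; PROVED; v4 verbatim) -/

/-- §G0 `g_L(E) := E·(y² + 2Ly + 2L²)`, `y = logWeight L Hs E`; `Φ_L = (η²/(c s²))·g_L`. -/
noncomputable def gL (L Hs E : ℝ) : ℝ := E * (logWeight L Hs E ^ 2 + 2 * L * logWeight L Hs E + 2 * L ^ 2)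

theorem gL_zero (L Hs : ℝ) : gL L Hs 0 = 0 := by simp [gL]

theorem gL_top (L Hs : ℝ) : gL L Hs (2 * Hs ^ 2) = 2 * Hs ^ 2 * (1 + 2 * L + 2 * L ^ 2) := by
  rw [gL, logWeight_top]; ring

theorem gL_nonneg (L Hs : ℝ) {E : ℝ} (hE : 0 ≤ E) : 0 ≤ gL L Hs E :=
  mul_nonneg hE (by nlinarith [sq_nonneg (logWeight L Hs E + L), sq_nonneg L])

/-- (K) the algebraic core of the tangent inequality: `t ≥ 1 + δ + δ²/2` (`t = e^δ`, `δ ≥ 0`), `y ≥ 1`, `L, E′ ≥ 0`. -/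
theorem tangent_core {L y δ t E' : ℝ} (hL : 0 ≤ L) (hy : 1 ≤ y) (ht : 1 + δ + δ ^ 2 / 2 ≤ t) (hE' : 0 ≤ E') :
    y ^ 2 * (E' * t - E') ≤ E' * t * (y ^ 2 + 2 * L * y + 2 * L ^ 2) - E' * ((y + L * δ) ^ 2 + 2 * L * (y + L * δ) + 2 * L ^ 2) := by
  nlinarith [mul_nonneg (mul_nonneg (mul_nonneg hE' hL) (by linarith : 0 ≤ y + L)) (by linarith : 0 ≤ t - 1 - δ - δ ^ 2 / 2),
    mul_nonneg (mul_nonneg (mul_nonneg hE' hL) (sq_nonneg δ)) (by linarith : (0 : ℝ) ≤ y)]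

/-- ★ (K) TANGENT INEQUALITY = concavity of `g_L` on `(0, 2Hs²]`: `0 ≤ L`, `0 < Hs`, `0 ≤ E′ ≤ E ≤ 2Hs²` ⇒ `y(E)²·(E − E′) ≤ g_L(E) − g_L(E′)`. -/
theorem gL_tangent {L Hs E E' : ℝ} (hL : 0 ≤ L) (hHs : 0 < Hs) (hE'0 : 0 ≤ E') (hE'E : E' ≤ E) (hEA : E ≤ 2 * Hs ^ 2) :
    logWeight L Hs E ^ 2 * (E - E') ≤ gL L Hs E - gL L Hs E' := by
  have hA : 0 < 2 * Hs ^ 2 := by positivity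
  rcases hE'0.eq_or_lt with h0 | hpos
  · rw [← h0, gL_zero, sub_zero, sub_zero, gL]
    have hE0 : 0 ≤ E := h0.le.trans hE'E
    rcases hE0.eq_or_lt with hz | hEpos
    · rw [← hz]; simp
    · have hy := one_le_logWeight hL hEpos hEA
      nlinarith [mul_nonneg (mul_nonneg hL hEpos.le) (by linarith : 0 ≤ logWeight L Hs E + L)]
  · have hEpos : 0 < E := hpos.trans_le hE'E
    have hy1 : 1 ≤ logWeight L Hs E := one_le_logWeight hL hEpos hEA
    set y := logWeight L Hs E with hy_def
    set δ := Real.log E - Real.log E' with hδ_def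
    have hδ0 : 0 ≤ δ := sub_nonneg.2 (Real.log_le_log hpos hE'E)
    set t := Real.exp δ with ht_def
    have hy' : logWeight L Hs E' = y + L * δ := by
      rw [hy_def, hδ_def, logWeight, logWeight, Real.log_div hA.ne' hpos.ne', Real.log_div hA.ne' hEpos.ne']; ring
    have ht : E = E' * t := by
      rw [ht_def, hδ_def, Real.exp_sub, Real.exp_log hEpos, Real.exp_log hpos]; field_simp
    have key := tangent_core hL hy1 (Real.quadratic_le_exp_of_nonneg hδ0) hpos.le (L := L)
    rw [gL, gL, hy', ← hy_def, ht]
    exact key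

/-! ## §G1 Level objects -/

/-- §G1 the TOUCHER HEIGHT of level `j`: `sSup` of `Im z` over the touchers `z` of the lowest band states (`sSup ∅ = 0`). -/
noncomputable def touchH : LevelMeter := fun η f x₀ s hmax R Hs B j =>
  sSup ((fun z : ℂ => z.im) '' {z : ℂ | ∃ v : ℂ, IsLowest StTrkDQ η f x₀ s hmax R Hs B j v ∧ Touches f j v z})

/-- §G1 the PAIR ENERGY meter `E j := lowH j² + touchH j²`. -/
noncomputable def touchEnergyQ : LevelMeter := fun η f x₀ s hmax R Hs B j =>
  lowH StTrkDQ η f x₀ s hmax R Hs B j ^ 2 + touchH η f x₀ s hmax R Hs B j ^ 2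

/-- §G1 the PAID β CLASS: approach levels whose lowest band state is touched by a strictly taller zero, the pair atomic, the field above the floor. -/
def BetaLevelQ (κ₀ : ℝ) : LevelClass := fun η f x₀ s hmax R Hs B j =>
  ApproachLevelQ η f x₀ s hmax R Hs B j ∧
    ∃ v z : ℂ, IsLowest StTrkDQ η f x₀ s hmax R Hs B j v ∧ Touches f j v z ∧ AtomicPair f j v z ∧ κ₀ ≤ v.im * stateKappa f j v

/-- §G1 a β-WITNESS of level `k`: a pair `p = (v, z)` carrying the socket's six level binders. -/
def BetaWitnessQ (κ₀ η : ℝ) (f : ℂ → ℂ) (x₀ s hmax R Hs : ℝ) (B k : ℕ) (p : ℂ × ℂ) : Prop :=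
  Charged (PTrkSQ PBot) StTrkDQ ReadyR2 η f x₀ s hmax R Hs B k ∧ ApproachLevelQ η f x₀ s hmax R Hs B k ∧
    IsLowest StTrkDQ η f x₀ s hmax R Hs B k p.1 ∧ Touches f k p.1 p.2 ∧ AtomicPair f k p.1 p.2 ∧ κ₀ ≤ p.1.im * stateKappa f k p.1

/-- §G1 `Φ_L(E) = (η²/(c s²))·g_L(E)` at a (frame) constant `c`. -/
noncomputable def phiLE (c L η s Hs E : ℝ) : ℝ := η ^ 2 / (c * s ^ 2) * gL L Hs E

open Classical in
/-- §G1 the FIRST β-LEVEL of a frame: `sInf {k | BetaLevelQ κ₀ k}` (junk `0` if there is none — then no β-level is ever booked). -/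
noncomputable def firstBetaQ (κ₀ η : ℝ) (f : ℂ → ℂ) (x₀ s hmax R Hs : ℝ) (B : ℕ) : ℕ :=
  sInf {k : ℕ | BetaLevelQ κ₀ η f x₀ s hmax R Hs B k}

/-- §G1 the β PURSE at the frame constant: `(1 + 2L + 2L²)·(Hs/s)²/(2·cF(F))` (`= Φ_L(2Hs²)` at `η = 1/2`). -/
noncomputable def betaPurseWQ (cF : Budget) (L : ℝ) : Budget := fun η f x₀ s hmax R Hs B =>
  (1 + 2 * L + 2 * L ^ 2) * (Hs / s) ^ 2 / (2 * cF η f x₀ s hmax R Hs B)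

/-- §G1 the REPAIRED β POTENTIAL `Φ̃_k`: the full purse before the first β-level, `Φ_L(E k)` (at the frame constant `cF(F)`) from it on. -/
noncomputable def betaPotentialWQ (cF : Budget) (L κ₀ : ℝ) : LevelMeter := fun η f x₀ s hmax R Hs B k =>
  if k < firstBetaQ κ₀ η f x₀ s hmax R Hs B then betaPurseWQ cF L η f x₀ s hmax R Hs B
  else phiLE (cF η f x₀ s hmax R Hs B) L η s Hs (touchEnergyQ η f x₀ s hmax R Hs B k)

open Classical in
/-- §G1 the RETOUCH RISE `RTB_k := [Φ_L(E (k+1)) − Φ_L(childEnergy Ū_k)]⁺` at a level with a β-witness (`Ū_k` of a CHOSEN witness; every law binder is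
`∀ v z`, so the choice is immaterial — Γ3′ is priced at the WORST toucher), else `0`. -/
noncomputable def retouchRiseWQ (cF : Budget) (L κ₀ : ℝ) : LevelMeter := fun η f x₀ s hmax R Hs B k =>
  if h : ∃ p : ℂ × ℂ, BetaWitnessQ κ₀ η f x₀ s hmax R Hs B k p then
    max (phiLE (cF η f x₀ s hmax R Hs B) L η s Hs (touchEnergyQ η f x₀ s hmax R Hs B (k + 1))
      - phiLE (cF η f x₀ s hmax R Hs B) L η s Hs (childEnergy f k (pairUnion (Classical.choose h).1 (Classical.choose h).2))) 0
  else 0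

/-- §G1 the RISE METER on Φ̃: `max([Φ̃(k+1) − Φ̃(k)]⁺, RTB_k) + 4·[−drop_k]⁺/s` (nothing is booked before the first β-level: Φ̃ is constant there). -/
noncomputable def touchRiseWQ (cF : Budget) (L κ₀ : ℝ) : LevelMeter := fun η f x₀ s hmax R Hs B k =>
  max (max (betaPotentialWQ cF L κ₀ η f x₀ s hmax R Hs B (k + 1) - betaPotentialWQ cF L κ₀ η f x₀ s hmax R Hs B k) 0)
      (retouchRiseWQ cF L κ₀ η f x₀ s hmax R Hs B k)
    + 4 * max (-dropQ η f x₀ s hmax R Hs B k) 0 / s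

/-! ## §G2 The named gaps (typed, OPEN — hypotheses of the glue, not sorries) -/

/-- (Γ2′ — CENSUS DICHOTOMY, NOT a binder of the glue) at a β-level either the next pair energy is at most the children's energy in `Ū` (persistence:
`RTB_k = 0`) or the next lowest state has a toucher OUTSIDE `Ū` (a RETOUCH, priced by `RTB_k`; price note `lens2/RETOUCH-PRICE-NOTE-v1.md`). -/
def PersistenceOrRetouchQ (κ₀ : ℝ) : Prop :=
  ∀ (η : ℝ) (f : ℂ → ℂ) (x₀ s hmax R Hs : ℝ) (B : ℕ), EngineHyps5 2 η f x₀ s hmax R Hs B →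
    ∀ (j : ℕ) (v z : ℂ), Charged (PTrkSQ PBot) StTrkDQ ReadyR2 η f x₀ s hmax R Hs B j → ApproachLevelQ η f x₀ s hmax R Hs B j →
      IsLowest StTrkDQ η f x₀ s hmax R Hs B j v → Touches f j v z → AtomicPair f j v z → κ₀ ≤ v.im * stateKappa f j v →
      touchEnergyQ η f x₀ s hmax R Hs B (j + 1) ≤ childEnergy f j (pairUnion v z) ∨
        ∃ v' ρ : ℂ, IsLowest StTrkDQ η f x₀ s hmax R Hs B (j + 1) v' ∧ Touches f (j + 1) v' ρ ∧ ρ ∉ pairUnion v z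

/-- (Γ3′, OPEN as to SIZE — LOAD-BEARING) RISE ALLOWANCE in Φ̃ units: before the horizon the booked rises `touchRiseWQ` stay within `aT`. -/
def TouchRiseLawWQ (cF : Budget) (L κ₀ : ℝ) (aT : Budget) : Prop :=
  ∀ (η : ℝ) (f : ℂ → ℂ) (x₀ s hmax R Hs : ℝ) (B : ℕ), EngineHyps5 2 η f x₀ s hmax R Hs B →
    ∀ k : ℕ, Charged (PTrkSQ PBot) StTrkDQ ReadyR2 η f x₀ s hmax R Hs B k →
      prefixSumQ (touchRiseWQ cF L κ₀) η f x₀ s hmax R Hs B (k + 1) ≤ aT η f x₀ s hmax R Hs B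

/-! ## §G3 Bookkeeping of the level objects (K) -/

theorem lowH_le_Hs {η : ℝ} {f : ℂ → ℂ} {x₀ s hmax R Hs : ℝ} {B : ℕ} (hE : EngineHyps5 2 η f x₀ s hmax R Hs B) (k : ℕ) :
    lowH StTrkDQ η f x₀ s hmax R Hs B k ≤ Hs := by
  have hHs : 0 ≤ Hs := hE.2.2.2.2.2.2.2.1
  by_cases hex : ∃ u : ℂ, StTrkDQ η f x₀ s hmax R Hs B k u
  · obtain ⟨u, hu⟩ := hex
    exact (lowH_le hu).trans (RhW08.Column.abs_im_le_of_level hE hu.1 hu.2.1)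
  · have hset : {u : ℂ | StTrkDQ η f x₀ s hmax R Hs B k u} = ∅ := by
      ext u
      simp only [Set.mem_setOf_eq, Set.mem_empty_iff_false, iff_false]
      exact fun hu => hex ⟨u, hu⟩
    show sInf ((fun u : ℂ => |u.im|) '' {u : ℂ | StTrkDQ η f x₀ s hmax R Hs B k u}) ≤ Hs
    rw [hset, Set.image_empty, Real.sInf_empty]
    exact hHs

theorem touchH_nonneg (η : ℝ) (f : ℂ → ℂ) (x₀ s hmax R Hs : ℝ) (B k : ℕ) : 0 ≤ touchH η f x₀ s hmax R Hs B k := by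
  refine Real.sSup_nonneg ?_
  rintro x ⟨z, ⟨v, hlow, ht⟩, rfl⟩
  exact ((hlow.1.2.2.1).trans ht.2.1).le

theorem touchH_le_Hs {η : ℝ} {f : ℂ → ℂ} {x₀ s hmax R Hs : ℝ} {B : ℕ} (hE : EngineHyps5 2 η f x₀ s hmax R Hs B) (k : ℕ) :
    touchH η f x₀ s hmax R Hs B k ≤ Hs := by
  refine Real.sSup_le ?_ hE.2.2.2.2.2.2.2.1
  rintro x ⟨z, ⟨v, hlow, ht⟩, rfl⟩
  exact (le_abs_self _).trans (RhW08.Column.abs_im_le_of_level hE hlow.1.1 ht.1)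

theorem touchEnergyQ_nonneg (η : ℝ) (f : ℂ → ℂ) (x₀ s hmax R Hs : ℝ) (B k : ℕ) : 0 ≤ touchEnergyQ η f x₀ s hmax R Hs B k := by
  unfold touchEnergyQ; positivity

theorem touchEnergyQ_le {η : ℝ} {f : ℂ → ℂ} {x₀ s hmax R Hs : ℝ} {B : ℕ} (hE : EngineHyps5 2 η f x₀ s hmax R Hs B) (k : ℕ) :
    touchEnergyQ η f x₀ s hmax R Hs B k ≤ 2 * Hs ^ 2 := by
  have h1 : lowH StTrkDQ η f x₀ s hmax R Hs B k ^ 2 ≤ Hs ^ 2 := pow_le_pow_left₀ lowH_nonneg' (lowH_le_Hs hE k) 2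
  have h2 : touchH η f x₀ s hmax R Hs B k ^ 2 ≤ Hs ^ 2 :=
    pow_le_pow_left₀ (touchH_nonneg η f x₀ s hmax R Hs B k) (touchH_le_Hs hE k) 2
  unfold touchEnergyQ; linarith

/-- (K) at a level with lowest band state `v` touched by `z`: `Im v² + Im z² ≤ E k`. -/
theorem pair_le_touchEnergyQ {η : ℝ} {f : ℂ → ℂ} {x₀ s hmax R Hs : ℝ} {B k : ℕ} {v z : ℂ} (hE : EngineHyps5 2 η f x₀ s hmax R Hs B)
    (hlow : IsLowest StTrkDQ η f x₀ s hmax R Hs B k v) (ht : Touches f k v z) :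
    v.im ^ 2 + z.im ^ 2 ≤ touchEnergyQ η f x₀ s hmax R Hs B k := by
  have hL : lowH StTrkDQ η f x₀ s hmax R Hs B k = v.im := lowH_eq_of_isLowest hlow
  have hbdd : BddAbove ((fun z : ℂ => z.im) '' {z : ℂ | ∃ v : ℂ, IsLowest StTrkDQ η f x₀ s hmax R Hs B k v ∧ Touches f k v z}) := by
    refine ⟨Hs, ?_⟩
    rintro x ⟨z', ⟨v', hlow', ht'⟩, rfl⟩
    exact (le_abs_self _).trans (RhW08.Column.abs_im_le_of_level hE hlow'.1.1 ht'.1)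
  have hz : z.im ≤ touchH η f x₀ s hmax R Hs B k := le_csSup hbdd ⟨z, ⟨v, hlow, ht⟩, rfl⟩
  have hz2 : z.im ^ 2 ≤ touchH η f x₀ s hmax R Hs B k ^ 2 := pow_le_pow_left₀ ((hlow.1.2.2.1.trans ht.2.1).le) hz 2
  unfold touchEnergyQ; rw [hL]; linarith

/-- (K) a touched lowest pair on a legal frame sits in the strip: `Im v² + Im z² ≤ 2Hs²` and `0 < Hs`. -/
theorem pair_le_twoHsSq {η : ℝ} {f : ℂ → ℂ} {x₀ s hmax R Hs : ℝ} {B k : ℕ} {v z : ℂ} (hE : EngineHyps5 2 η f x₀ s hmax R Hs B)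
    (hlow : IsLowest StTrkDQ η f x₀ s hmax R Hs B k v) (ht : Touches f k v z) :
    v.im ^ 2 + z.im ^ 2 ≤ 2 * Hs ^ 2 ∧ 0 < Hs := by
  have hv : |v.im| ≤ Hs := RhW08.Column.abs_im_le_of_level hE hlow.1.1 hlow.1.2.1
  have hz : |z.im| ≤ Hs := RhW08.Column.abs_im_le_of_level hE hlow.1.1 ht.1
  have hv2 : v.im ^ 2 ≤ Hs ^ 2 := by rw [← sq_abs]; exact pow_le_pow_left₀ (abs_nonneg _) hv 2
  have hz2 : z.im ^ 2 ≤ Hs ^ 2 := by rw [← sq_abs]; exact pow_le_pow_left₀ (abs_nonneg _) hz 2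
  exact ⟨by linarith, hlow.1.2.2.1.trans_le ((le_abs_self _).trans hv)⟩

theorem phiLE_nonneg {c : ℝ} (hc : 0 < c) (L η s Hs : ℝ) {E : ℝ} (hE : 0 ≤ E) : 0 ≤ phiLE c L η s Hs E := by
  unfold phiLE
  exact mul_nonneg (div_nonneg (sq_nonneg η) (mul_nonneg hc.le (sq_nonneg s))) (gL_nonneg L Hs hE)

/-- ★ (K) THE PAYING INEQUALITY of Φ_L: `0 ≤ E′ ≤ E ≤ 2Hs²` ⇒ `(η²/(c s²))·y(E)²·(E − E′) ≤ Φ_L(E) − Φ_L(E′)`. -/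
theorem phiLE_sub_ge {c L η s Hs E E' : ℝ} (hc : 0 < c) (hL : 0 ≤ L) (hHs : 0 < Hs) (hE'0 : 0 ≤ E') (hE'E : E' ≤ E)
    (hEA : E ≤ 2 * Hs ^ 2) : η ^ 2 / (c * s ^ 2) * (logWeight L Hs E ^ 2 * (E - E')) ≤ phiLE c L η s Hs E - phiLE c L η s Hs E' := by
  unfold phiLE; rw [← mul_sub]
  exact mul_le_mul_of_nonneg_left (gL_tangent hL hHs hE'0 hE'E hEA) (div_nonneg (sq_nonneg η) (mul_nonneg hc.le (sq_nonneg s)))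

theorem phiLE_mono {c L η s Hs E E' : ℝ} (hc : 0 < c) (hL : 0 ≤ L) (hHs : 0 < Hs) (hE'0 : 0 ≤ E') (hE'E : E' ≤ E)
    (hEA : E ≤ 2 * Hs ^ 2) : phiLE c L η s Hs E' ≤ phiLE c L η s Hs E := by
  have h := phiLE_sub_ge (η := η) (s := s) hc hL hHs hE'0 hE'E hEA
  have h0 : 0 ≤ η ^ 2 / (c * s ^ 2) * (logWeight L Hs E ^ 2 * (E - E')) :=
    mul_nonneg (div_nonneg (sq_nonneg η) (mul_nonneg hc.le (sq_nonneg s))) (mul_nonneg (sq_nonneg _) (sub_nonneg.2 hE'E))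
  linarith

/-- ★ (K) THE PURSE of Φ_L: `0 ≤ E ≤ 2Hs²`, `0 ≤ Hs`, `0 ≤ η ≤ 1/2` ⇒ `Φ_L(E) ≤ (1 + 2L + 2L²)·(Hs/s)²/(2c)`. -/
theorem phiLE_le_purse {c L η s Hs E : ℝ} (hc : 0 < c) (hL : 0 ≤ L) (hs : 0 < s) (hη0 : 0 ≤ η) (hη1 : 2 * η ≤ 1) (hHs : 0 ≤ Hs)
    (hE0 : 0 ≤ E) (hEA : E ≤ 2 * Hs ^ 2) : phiLE c L η s Hs E ≤ (1 + 2 * L + 2 * L ^ 2) * (Hs / s) ^ 2 / (2 * c) := by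
  have hη2 : η ^ 2 ≤ 1 / 4 := by nlinarith
  have hq : 0 ≤ 1 + 2 * L + 2 * L ^ 2 := by nlinarith
  rcases hHs.eq_or_lt with hz | hHs'
  · have hE : E = 0 := le_antisymm (by rw [← hz] at hEA; simpa using hEA) hE0
    rw [hE, phiLE, gL_zero, mul_zero]
    positivity
  · have htop : gL L Hs E ≤ 2 * Hs ^ 2 * (1 + 2 * L + 2 * L ^ 2) := by
      have h := gL_tangent hL hHs' hE0 hEA le_rfl
      rw [gL_top, logWeight_top] at h
      nlinarith
    have hcoef : 0 ≤ η ^ 2 / (c * s ^ 2) := by positivity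
    calc phiLE c L η s Hs E = η ^ 2 / (c * s ^ 2) * gL L Hs E := rfl
      _ ≤ η ^ 2 / (c * s ^ 2) * (2 * Hs ^ 2 * (1 + 2 * L + 2 * L ^ 2)) := mul_le_mul_of_nonneg_left htop hcoef
      _ = 2 * Hs ^ 2 * (1 + 2 * L + 2 * L ^ 2) / (c * s ^ 2) * η ^ 2 := by ring
      _ ≤ 2 * Hs ^ 2 * (1 + 2 * L + 2 * L ^ 2) / (c * s ^ 2) * (1 / 4) :=
          mul_le_mul_of_nonneg_left hη2 (by positivity)
      _ = (1 + 2 * L + 2 * L ^ 2) * (Hs / s) ^ 2 / (2 * c) := by field_simp; ring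

/-- (K) per-frame reading of the β purse. -/
theorem betaPurseWQ_apply (cF : Budget) (L η : ℝ) (f : ℂ → ℂ) (x₀ s hmax R Hs : ℝ) (B : ℕ) :
    betaPurseWQ cF L η f x₀ s hmax R Hs B = (1 + 2 * L + 2 * L ^ 2) * (Hs / s) ^ 2 / (2 * cF η f x₀ s hmax R Hs B) := rfl

/-- (K) a β-level is not before the first β-level. -/
theorem firstBetaQ_le {κ₀ η : ℝ} {f : ℂ → ℂ} {x₀ s hmax R Hs : ℝ} {B k : ℕ} (hk : BetaLevelQ κ₀ η f x₀ s hmax R Hs B k) :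
    firstBetaQ κ₀ η f x₀ s hmax R Hs B ≤ k :=
  Nat.sInf_le hk

/-- (K) the two cases of Φ̃. -/
theorem betaPotentialWQ_of_le {cF : Budget} {L κ₀ η : ℝ} {f : ℂ → ℂ} {x₀ s hmax R Hs : ℝ} {B k : ℕ}
    (hk : firstBetaQ κ₀ η f x₀ s hmax R Hs B ≤ k) : betaPotentialWQ cF L κ₀ η f x₀ s hmax R Hs B k
      = phiLE (cF η f x₀ s hmax R Hs B) L η s Hs (touchEnergyQ η f x₀ s hmax R Hs B k) := by
  unfold betaPotentialWQ; rw [if_neg (not_lt.2 hk)]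

theorem betaPotentialWQ_of_lt {cF : Budget} {L κ₀ η : ℝ} {f : ℂ → ℂ} {x₀ s hmax R Hs : ℝ} {B k : ℕ}
    (hk : k < firstBetaQ κ₀ η f x₀ s hmax R Hs B) :
    betaPotentialWQ cF L κ₀ η f x₀ s hmax R Hs B k = betaPurseWQ cF L η f x₀ s hmax R Hs B := by
  unfold betaPotentialWQ; rw [if_pos hk]

/-! ## §G4 ★ The β class law from the socket + Γ3′ — PROVED (no persistence hypothesis, no state cap) -/

open Classical in
set_option maxHeartbeats 800000 in
/-- ★★ (K) **W(cF) + RISE ALLOWANCE ⟹ the β CLASS LAW** with allowance `betaPurseWQ cF L + aT`, by the books' socket `classLawQ_of_potential_rises` with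
`Φ = Φ̃` and rise meter `touchRiseWQ`: at a charged β-level `k` (so `firstBetaQ ≤ k` and Φ̃ = Φ_L there and at `k+1`)
`Φ_L(E_k) ≥ Φ_L(e_k) ≥ Φ_L(childEnergy Ū_k) + 1 ≥ Φ_L(E_{k+1}) − RTB_k + 1` (monotonicity; the paying inequality at the pair energy `e_k` read against the
socket row at the frame constant `cF(F) > 0`; the definition of `RTB_k`); off β-levels `Φ̃(k+1) − Φ̃(k) ≤ meter`. -/
theorem betaClassLaw_of_TW {cF : Budget} {L κ₀ : ℝ} {aT : Budget}
    (hcF : ∀ (η : ℝ) (f : ℂ → ℂ) (x₀ s hmax R Hs : ℝ) (B : ℕ), EngineHyps5 2 η f x₀ s hmax R Hs B → 0 < cF η f x₀ s hmax R Hs B)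
    (hL : 0 ≤ L) (hT : TouchedDissipationLawWQ cF L κ₀) (hrise : TouchRiseLawWQ cF L κ₀ aT) :
    ClassLawQ (BetaLevelQ κ₀) (addBudget (betaPurseWQ cF L) aT) := by
  refine classLawQ_of_potential_rises (betaPotentialWQ cF L κ₀) (touchRiseWQ cF L κ₀) ?_
  intro η f x₀ s hmax R Hs B hE
  have hc : 0 < cF η f x₀ s hmax R Hs B := hcF η f x₀ s hmax R Hs B hE
  have hs : 0 < s := hE.2.2.2.1
  have hHs0 : 0 ≤ Hs := hE.2.2.2.2.2.2.2.1
  have hη0 : 0 ≤ η := hE.2.2.2.2.2.2.2.2.2.2.2.2.2.1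
  have hη1 : 2 * η ≤ 1 := hE.2.2.2.2.2.2.2.2.2.2.2.2.2.2.1
  have hpurse0 : 0 ≤ betaPurseWQ cF L η f x₀ s hmax R Hs B := by
    rw [betaPurseWQ_apply]
    exact div_nonneg (mul_nonneg (by nlinarith) (sq_nonneg _)) (by positivity)
  have hΦle : ∀ k : ℕ, firstBetaQ κ₀ η f x₀ s hmax R Hs B ≤ k →
      betaPotentialWQ cF L κ₀ η f x₀ s hmax R Hs B k ≤ betaPurseWQ cF L η f x₀ s hmax R Hs B := fun k hk => by
    rw [betaPotentialWQ_of_le hk, betaPurseWQ_apply]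
    exact phiLE_le_purse hc hL hs hη0 hη1 hHs0 (touchEnergyQ_nonneg η f x₀ s hmax R Hs B k) (touchEnergyQ_le hE k)
  refine ⟨fun k => ?_, ?_, fun k hk => hrise η f x₀ s hmax R Hs B hE k hk, fun k _ => ?_⟩
  · by_cases hk : k < firstBetaQ κ₀ η f x₀ s hmax R Hs B
    · rw [betaPotentialWQ_of_lt hk]; exact hpurse0
    · rw [betaPotentialWQ_of_le (not_lt.1 hk)]
      exact phiLE_nonneg hc L η s Hs (touchEnergyQ_nonneg η f x₀ s hmax R Hs B k)
  · show betaPotentialWQ cF L κ₀ η f x₀ s hmax R Hs B 0 ≤ betaPurseWQ cF L η f x₀ s hmax R Hs B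
    by_cases h0 : 0 < firstBetaQ κ₀ η f x₀ s hmax R Hs B
    · rw [betaPotentialWQ_of_lt h0]
    · exact hΦle 0 (Nat.le_of_not_lt h0)
  · -- the step across level `k`
    have hdrop : -(4 * dropQ η f x₀ s hmax R Hs B k / s) ≤ 4 * max (-dropQ η f x₀ s hmax R Hs B k) 0 / s := by
      rw [← neg_div, ← mul_neg]
      exact div_le_div_of_nonneg_right (mul_le_mul_of_nonneg_left (le_max_left _ _) (by norm_num)) hs.le
    have hm1 : betaPotentialWQ cF L κ₀ η f x₀ s hmax R Hs B (k + 1) - betaPotentialWQ cF L κ₀ η f x₀ s hmax R Hs B k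
        ≤ max (max (betaPotentialWQ cF L κ₀ η f x₀ s hmax R Hs B (k + 1) - betaPotentialWQ cF L κ₀ η f x₀ s hmax R Hs B k) 0)
            (retouchRiseWQ cF L κ₀ η f x₀ s hmax R Hs B k) := (le_max_left _ _).trans (le_max_left _ _)
    have hR' : retouchRiseWQ cF L κ₀ η f x₀ s hmax R Hs B k
        ≤ max (max (betaPotentialWQ cF L κ₀ η f x₀ s hmax R Hs B (k + 1) - betaPotentialWQ cF L κ₀ η f x₀ s hmax R Hs B k) 0)
            (retouchRiseWQ cF L κ₀ η f x₀ s hmax R Hs B k) := le_max_right _ _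
    have hd0 : 0 ≤ 4 * max (-dropQ η f x₀ s hmax R Hs B k) 0 / s := by positivity
    by_cases hj : Charged (PTrkSQ PBot) StTrkDQ ReadyR2 η f x₀ s hmax R Hs B k ∧ BetaLevelQ κ₀ η f x₀ s hmax R Hs B k
    · rw [if_pos hj]
      obtain ⟨hch, hβ⟩ := hj
      have hfb : firstBetaQ κ₀ η f x₀ s hmax R Hs B ≤ k := firstBetaQ_le hβ
      obtain ⟨happ, v, z, hlow, ht, ha, hfl⟩ := hβ
      have hex : ∃ p : ℂ × ℂ, BetaWitnessQ κ₀ η f x₀ s hmax R Hs B k p := ⟨(v, z), hch, happ, hlow, ht, ha, hfl⟩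
      obtain ⟨hch', happ', hlow', ht', ha', hfl'⟩ := Classical.choose_spec hex
      have hRTB : retouchRiseWQ cF L κ₀ η f x₀ s hmax R Hs B k
          = max (phiLE (cF η f x₀ s hmax R Hs B) L η s Hs (touchEnergyQ η f x₀ s hmax R Hs B (k + 1))
              - phiLE (cF η f x₀ s hmax R Hs B) L η s Hs
                  (childEnergy f k (pairUnion (Classical.choose hex).1 (Classical.choose hex).2))) 0 := by
        unfold retouchRiseWQ; rw [dif_pos hex]
      have hΦk := betaPotentialWQ_of_le (cF := cF) (L := L) hfb
      have hΦk1 := betaPotentialWQ_of_le (cF := cF) (L := L) (hfb.trans (Nat.le_succ k))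
      -- the chosen pair's energies
      have hrow := hT η f x₀ s hmax R Hs B hE k _ _ hch' happ' hlow' ht' ha' hfl'
      have hΔ0 := drop_nonneg_of_lawWQ hT hE hc hch' happ' hlow' ht' ha' hfl'
      obtain ⟨he2, hHs⟩ := pair_le_twoHsSq hE hlow' ht'
      have hcE0 : 0 ≤ childEnergy f k (pairUnion (Classical.choose hex).1 (Classical.choose hex).2) := childEnergy_nonneg _ _ _
      have hcEe : childEnergy f k (pairUnion (Classical.choose hex).1 (Classical.choose hex).2)
          ≤ (Classical.choose hex).1.im ^ 2 + (Classical.choose hex).2.im ^ 2 := by linarith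
      have heE := pair_le_touchEnergyQ hE hlow' ht'
      have hEk2 := touchEnergyQ_le hE k
      -- (1) the potential pays at least one unit between the pair energy and the children's energy
      have htan := phiLE_sub_ge (η := η) (s := s) hc hL hHs hcE0 hcEe he2
      have hunit : 1 ≤ η ^ 2 / (cF η f x₀ s hmax R Hs B * s ^ 2)
          * (logWeight L Hs ((Classical.choose hex).1.im ^ 2 + (Classical.choose hex).2.im ^ 2) ^ 2
            * (((Classical.choose hex).1.im ^ 2 + (Classical.choose hex).2.im ^ 2)
              - childEnergy f k (pairUnion (Classical.choose hex).1 (Classical.choose hex).2))) := by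
        rw [div_mul_eq_mul_div, le_div_iff₀ (by positivity), one_mul]
        linarith
      have hpay := hunit.trans htan
      -- (2) monotonicity from the pair energy up to the meter
      have hmono := phiLE_mono (η := η) (s := s) hc hL hHs (by positivity) heE hEk2
      -- (3) the retouch rise covers the rest
      have hR : phiLE (cF η f x₀ s hmax R Hs B) L η s Hs (touchEnergyQ η f x₀ s hmax R Hs B (k + 1))
          - phiLE (cF η f x₀ s hmax R Hs B) L η s Hs (childEnergy f k (pairUnion (Classical.choose hex).1 (Classical.choose hex).2))
          ≤ retouchRiseWQ cF L κ₀ η f x₀ s hmax R Hs B k := by rw [hRTB]; exact le_max_left _ _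
      show betaPotentialWQ cF L κ₀ η f x₀ s hmax R Hs B (k + 1) + (1 - 4 * dropQ η f x₀ s hmax R Hs B k / s)
        ≤ betaPotentialWQ cF L κ₀ η f x₀ s hmax R Hs B k
          + (max (max (betaPotentialWQ cF L κ₀ η f x₀ s hmax R Hs B (k + 1) - betaPotentialWQ cF L κ₀ η f x₀ s hmax R Hs B k) 0)
              (retouchRiseWQ cF L κ₀ η f x₀ s hmax R Hs B k)
            + 4 * max (-dropQ η f x₀ s hmax R Hs B k) 0 / s)
      rw [hΦk, hΦk1] at hm1 hR' ⊢
      linarith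
    · rw [if_neg hj, add_zero]
      show betaPotentialWQ cF L κ₀ η f x₀ s hmax R Hs B (k + 1)
        ≤ betaPotentialWQ cF L κ₀ η f x₀ s hmax R Hs B k
          + (max (max (betaPotentialWQ cF L κ₀ η f x₀ s hmax R Hs B (k + 1) - betaPotentialWQ cF L κ₀ η f x₀ s hmax R Hs B k) 0)
              (retouchRiseWQ cF L κ₀ η f x₀ s hmax R Hs B k)
            + 4 * max (-dropQ η f x₀ s hmax R Hs B k) 0 / s)
      linarith

/-! ## §G5 ★★ Composition to ★A's literal type -/

/-- (K) class laws are MONOTONE in the allowance (on legal frames). -/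
theorem classLawQ_mono {𝓚 : LevelClass} {a a' : Budget} (h : ClassLawQ 𝓚 a)
    (hle : ∀ (η : ℝ) (f : ℂ → ℂ) (x₀ s hmax R Hs : ℝ) (B : ℕ), EngineHyps5 2 η f x₀ s hmax R Hs B →
      a η f x₀ s hmax R Hs B ≤ a' η f x₀ s hmax R Hs B) : ClassLawQ 𝓚 a' :=
  fun η f x₀ s hmax R Hs B hE k hk => (h η f x₀ s hmax R Hs B hE k hk).trans (hle η f x₀ s hmax R Hs B hE)

/-- (K) ★A's class reassembled: a β class law and a law for the REST of the approach class give `ApproachAllowanceQ (aβ + aRest)`. -/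
theorem approachAllowanceQ_of_beta_rest {κ₀ : ℝ} {aβ aRest : Budget} (hβ : ClassLawQ (BetaLevelQ κ₀) aβ)
    (hrest : ClassLawQ (diffClass ApproachLevelQ (BetaLevelQ κ₀)) aRest) : ApproachAllowanceQ (addBudget aβ aRest) := by
  have hU := classLawQ_union hβ hrest
  exact classLawQ_congr (fun η f x₀ s hmax R Hs B j => ⟨fun h => h.elim (fun hb => hb.1) id, fun h => Or.inr h⟩) hU

/-- ★★ (K, modulo the NAMED hypotheses) **THE GLUE v5**: W(cF) with `cF > 0` on legal frames + (Γ3′) RISE ALLOWANCE + (Γ4) the rest of the approach class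
+ FIT_W ⟹ `ApproachAllowanceQ (approachBudgetHalfQ aR aC)` for ANY budgets `aR aC` the fit is stated against. -/
theorem approachC_of_TW {cF : Budget} {L κ₀ : ℝ} {aT aRest aR aC : Budget}
    (hcF : ∀ (η : ℝ) (f : ℂ → ℂ) (x₀ s hmax R Hs : ℝ) (B : ℕ), EngineHyps5 2 η f x₀ s hmax R Hs B → 0 < cF η f x₀ s hmax R Hs B)
    (hL : 0 ≤ L) (hT : TouchedDissipationLawWQ cF L κ₀) (hrise : TouchRiseLawWQ cF L κ₀ aT)
    (hrest : ClassLawQ (diffClass ApproachLevelQ (BetaLevelQ κ₀)) aRest)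
    (hfit : ∀ (η : ℝ) (f : ℂ → ℂ) (x₀ s hmax R Hs : ℝ) (B : ℕ), EngineHyps5 2 η f x₀ s hmax R Hs B →
      betaPurseWQ cF L η f x₀ s hmax R Hs B + aT η f x₀ s hmax R Hs B + aRest η f x₀ s hmax R Hs B
        ≤ approachBudgetHalfQ aR aC η f x₀ s hmax R Hs B) :
    ApproachAllowanceQ (approachBudgetHalfQ aR aC) :=
  classLawQ_mono (approachAllowanceQ_of_beta_rest (betaClassLaw_of_TW hcF hL hT hrise) hrest)
    (fun η f x₀ s hmax R Hs B hE => by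
      show betaPurseWQ cF L η f x₀ s hmax R Hs B + aT η f x₀ s hmax R Hs B + aRest η f x₀ s hmax R Hs B ≤ _
      exact hfit η f x₀ s hmax R Hs B hE)

/-- ★★ (K) the CANONICAL instance — literally the registry's `stub_approachC` conclusion `ApproachAllowanceQ (approachBudgetHalfQ riseSupQ consSupQ)`. -/
theorem approachC_of_TW_canonical {cF : Budget} {L κ₀ : ℝ} {aT aRest : Budget}
    (hcF : ∀ (η : ℝ) (f : ℂ → ℂ) (x₀ s hmax R Hs : ℝ) (B : ℕ), EngineHyps5 2 η f x₀ s hmax R Hs B → 0 < cF η f x₀ s hmax R Hs B)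
    (hL : 0 ≤ L) (hT : TouchedDissipationLawWQ cF L κ₀) (hrise : TouchRiseLawWQ cF L κ₀ aT)
    (hrest : ClassLawQ (diffClass ApproachLevelQ (BetaLevelQ κ₀)) aRest)
    (hfit : ∀ (η : ℝ) (f : ℂ → ℂ) (x₀ s hmax R Hs : ℝ) (B : ℕ), EngineHyps5 2 η f x₀ s hmax R Hs B →
      betaPurseWQ cF L η f x₀ s hmax R Hs B + aT η f x₀ s hmax R Hs B + aRest η f x₀ s hmax R Hs B
        ≤ approachBudgetHalfQ riseSupQ consSupQ η f x₀ s hmax R Hs B) :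
    ApproachAllowanceQ (approachBudgetHalfQ riseSupQ consSupQ) :=
  approachC_of_TW hcF hL hT hrise hrest hfit

/-- ★★ (K) **T⁗ INSTANCE WITH THE TWO-BRACKET FIT_W**: since `w_F ≤ 1 + θ·(B+1)·(s/Hs)²`, the weighted purse is at most `φ₀·(Hs/s)² + φ₀·θ·(B+1)`
(`φ₀ = (1+2L+2L²)/(2c)`: the P-bracket and the B-bracket of the benches), so T⁗(c, L, κ₀, θ) + Γ3′ + Γ4 + that fit give ★A at the canonical budgets. -/
theorem approachC_of_TQ_brackets {c L κ₀ θ : ℝ} {aT aRest : Budget} (hc : 0 < c) (hL : 0 ≤ L) (hθ : 0 ≤ θ)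
    (hT : TouchedDissipationLawTQ c L κ₀ θ) (hrise : TouchRiseLawWQ (weightedConstQ c θ) L κ₀ aT)
    (hrest : ClassLawQ (diffClass ApproachLevelQ (BetaLevelQ κ₀)) aRest)
    (hfit : ∀ (η : ℝ) (f : ℂ → ℂ) (x₀ s hmax R Hs : ℝ) (B : ℕ), EngineHyps5 2 η f x₀ s hmax R Hs B →
      (1 + 2 * L + 2 * L ^ 2) / (2 * c) * (Hs / s) ^ 2 + (1 + 2 * L + 2 * L ^ 2) / (2 * c) * θ * ((B : ℝ) + 1)
        + aT η f x₀ s hmax R Hs B + aRest η f x₀ s hmax R Hs B ≤ approachBudgetHalfQ riseSupQ consSupQ η f x₀ s hmax R Hs B) :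
    ApproachAllowanceQ (approachBudgetHalfQ riseSupQ consSupQ) := by
  refine approachC_of_TW (fun η f x₀ s hmax R Hs B _ => weightedConstQ_pos hc θ η f x₀ s hmax R Hs B) hL hT hrise hrest
    (fun η f x₀ s hmax R Hs B hE => ?_)
  have hs : 0 < s := hE.2.2.2.1
  have hq : 0 ≤ 1 + 2 * L + 2 * L ^ 2 := by nlinarith
  have hw := frameWeightQ_le hθ η f x₀ s hmax R Hs B
  have hw0 := frameWeightQ_pos θ η f x₀ s hmax R Hs B
  -- `(Hs/s)²·(s/Hs)² ≤ 1` (`= 1` unless `Hs = 0`, when it is `0`)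
  have hprod : (Hs / s) ^ 2 * (s / Hs) ^ 2 ≤ 1 := by
    by_cases hHs : Hs = 0
    · rw [hHs]; simp
    · rw [← mul_pow, div_mul_div_comm, mul_comm Hs s, div_self (mul_ne_zero hs.ne' hHs)]; norm_num
  have hp : betaPurseWQ (weightedConstQ c θ) L η f x₀ s hmax R Hs B
      = (1 + 2 * L + 2 * L ^ 2) / (2 * c) * (Hs / s) ^ 2 * frameWeightQ θ η f x₀ s hmax R Hs B := by
    rw [betaPurseWQ_apply]; unfold weightedConstQ; field_simp
  have hb : betaPurseWQ (weightedConstQ c θ) L η f x₀ s hmax R Hs B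
      ≤ (1 + 2 * L + 2 * L ^ 2) / (2 * c) * (Hs / s) ^ 2 + (1 + 2 * L + 2 * L ^ 2) / (2 * c) * θ * ((B : ℝ) + 1) := by
    rw [hp]
    have hφ0 : 0 ≤ (1 + 2 * L + 2 * L ^ 2) / (2 * c) * (Hs / s) ^ 2 := by positivity
    calc (1 + 2 * L + 2 * L ^ 2) / (2 * c) * (Hs / s) ^ 2 * frameWeightQ θ η f x₀ s hmax R Hs B
        ≤ (1 + 2 * L + 2 * L ^ 2) / (2 * c) * (Hs / s) ^ 2 * (1 + θ * ((B : ℝ) + 1) * (s / Hs) ^ 2) :=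
          mul_le_mul_of_nonneg_left hw hφ0
      _ = (1 + 2 * L + 2 * L ^ 2) / (2 * c) * (Hs / s) ^ 2
          + (1 + 2 * L + 2 * L ^ 2) / (2 * c) * θ * ((B : ℝ) + 1) * ((Hs / s) ^ 2 * (s / Hs) ^ 2) := by ring
      _ ≤ (1 + 2 * L + 2 * L ^ 2) / (2 * c) * (Hs / s) ^ 2 + (1 + 2 * L + 2 * L ^ 2) / (2 * c) * θ * ((B : ℝ) + 1) * 1 := by
          have hk : 0 ≤ (1 + 2 * L + 2 * L ^ 2) / (2 * c) * θ * ((B : ℝ) + 1) := by positivity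
          linarith [mul_le_mul_of_nonneg_left hprod hk]
      _ = _ := by ring
  linarith [hfit η f x₀ s hmax R Hs B hE]

end RhW08.TouchedGlueW
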